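import Mathlib.Data.Real.Basic
import Mathlib.Algebra.Order.Field.Basic
import Mathlib.Algebra.BigOperators.Group.List.Basic
import Mathlib.Tactic.Linarith
import Mathlib.Tactic.Positivity
import Mathlib.Tactic.Ring
import Mathlib.Tactic.Push
import Mathlib.Tactic.LinearCombination
import Mathlib.Tactic.GCongr

/-!
# ChartedZeroExcessLayeredLatticeLiouville · ZZZYRCXK — THE θ⁰ SLAB KERNEL (route (B) of record) AND ITS GENERIC LEMMAS
(decomp-a2c hand-1 g54; target stmt-AtomisticToContinuum-26636 JS-D near reader; critic r1840 (C), r1842 R1/R2/R4, r1843)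

§1 the kernel PROGRAM evaluated by `decide +kernel` in every θ⁰ slab file (format v8; python twin `gen_theta_v8.py`): chords are lists of
index-coordinate site codes `((γ₀+600)·1201+(γ₁+600))·1201+(m+600)`, the hot loop is ℕ-only (offset refined coordinates
`x = v + (3603, 3603, 1201)`, the chord's `d18`-form split by sign), per piece it validates `0 < p9 ≤ P9max`, recomputes lens-2's dyadic
coefficients `coefR = ⌈2^E·n·45927/u9⁴⌉`, `coefN = ⌈2^E·n·45927·(4·u9·p9 − d18²)/(4·u9⁵·p9)⌉` and adds them at the piece key
`(m_a mod p, Δγ₀, Δγ₁, Δm)` in a static balanced payload tree (`none` on any invalid piece or missing key); measured 2.3 ms/incidence.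
§2 payload-tree lemmas (`bump` modifies exactly one listed entry with the right key; key-wise sums `tabR`/`tabN` add up), §3 the dyadic
ceiling lemma (`a/(2^E·b) ≤ ⌈a/b⌉/2^E` for the `(a + b − 1)/b` form), §4 the hex-metric Cauchy–Schwarz `d18² ≤ 4·n9·n9'` (so the ℕ subtraction
in `coefN` is exact), §5 the offset identities of the hot loop (ℕ expressions = the signed refined quantities).  The walk invariant, the
decoding to lens-2's `ChordDatum` and the completeness count are the second file (they import lens-2's reader shape RCX).
Mathlib only; 0 sorry.  All `[folklore]`.
-/

namespace Summit.AtomisticToContinuum.Crystallization.Theorems.ChartedZeroExcessLayeredLatticeLiouville.ThetaKernel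

/-! ## §1 the program -/

/-- payload tree: key code ↦ (SR, SN). -/
inductive PT where
  | nil : PT
  | node : PT → ℕ → ℕ → ℕ → PT → PT
/-- add `(r, s)` at key `q`; `none` if the key is absent (recursor form + `bif`: the cheap kernel idiom; soundness needs the failure). -/
noncomputable def PT.bump (q r s : ℕ) (t : PT) : Option PT :=
  PT.rec (motive := fun _ => Option PT) none
    (fun l k a b rt bl brt => bif Nat.blt q k then (match bl with | none => none | some l' => some (PT.node l' k a b rt))
      else bif Nat.blt k q then (match brt with | none => none | some r' => some (PT.node l k a b r'))
      else some (PT.node l k (Nat.add a r) (Nat.add b s) rt)) t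
/-- in-order list `(key, SR, SN)`. -/
noncomputable def PT.toList (t : PT) : List (ℕ × ℕ × ℕ) :=
  PT.rec (motive := fun _ => List (ℕ × ℕ × ℕ)) [] (fun _ k a b _ bl brt => bl ++ (k, a, b) :: brt) t

/-- registry letter of the shifted layer `am = m + 600` for a word of period `p ∣ 612`: `w[(am + 12) mod p] = w[m mod p]`. -/
def regN (w : List ℕ) (p am : ℕ) : ℕ := w.getD ((am + 12) % p) 0
/-- the last code of a chord (= `Y`), default `d`. -/
def lastD : List ℕ → ℕ → ℕ
  | [], d => d
  | c :: rest, _ => lastD rest c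

/-- ★ HOT LOOP (Nat only).  Current site `(a0, a1, am)` (shifted index coordinates); per piece: decode `b`, offset refined vector
`x = v + (3603, 3603, 1201)` (exact: every code is guarded `< 1201³`, so all shifted coordinates are `< 1201`) (`v0 = 3Δγ₀ + reg b − reg a`, …), `p9 = qhex(v0,v1) + 6vm²`, test `0 < p9 ≤ P9`, `|d18| = |P − Q|` from the
sign-split chord form `(f0p − f0n, f1p − f1n, gp − gn, Cp − Cn)`, `coefN = ⌈An·(U4n·p9 − d18²)/(Bn·p9)⌉`, bump at the piece key. -/
noncomputable def walkP (w : List ℕ) (p P9 f0p f0n f1p f1n gp gn Cp Cn An Bn U4n cR : ℕ) :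
    ℕ → ℕ → ℕ → List ℕ → PT → Option PT
  | _, _, _, [], t => some t
  | a0, a1, am, c :: rest, t =>
      let b0 := c / 1442401
      let b1 := c / 1201 % 1201
      let bm := c % 1201
      let ra := regN w p am
      let rb := regN w p bm
      let x0 := 3 * (b0 + 1201 - a0) + rb - ra
      let x1 := 3 * (b1 + 1201 - a1) + rb - ra
      let xm := bm + 1201 - am
      let p9n := x0 * x0 + x0 * x1 + x1 * x1 + 38944827 + 6 * (xm * xm) + 8654406 - (10809 * (x0 + x1) + 14412 * xm)
      bif (!(Nat.blt c 1732323601) || Nat.beq p9n 0 || Nat.blt P9 p9n) then none else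
      let P := f0p * x0 + f1p * x1 + gp * xm + Cn
      let Q := f0n * x0 + f1n * x1 + gn * xm + Cp
      let da := (P - Q) + (Q - P)
      let den := Bn * p9n
      let cN := (An * (U4n * p9n - da * da) + den - 1) / den
      match t.bump (((((am + 12) % p) * 1201 + (b0 + 600 - a0)) * 1201 + (b1 + 600 - a1)) * 1201 + (bm + 600 - am)) cR cN with
      | none => none
      | some t' => walkP w p P9 f0p f0n f1p f1n gp gn Cp Cn An Bn U4n cR b0 b1 bm rest t'

/-- ONE CHORD from base site `X = (0, 0, mX)`: ideal chord vector `e`, window `lo < u9 ≤ hi`, `n = #codes`, per-chord constants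
`An = 2^E·45927·n`, `Bn = 4·u9⁵`, `U4n = 4·u9`, `coefR = ⌈An/u9⁴⌉`, sign-split linear form of `d18(e, ·)`, then the walk. -/
noncomputable def addChord (w : List ℕ) (p P9 AE mX : ℕ) (lo hi : ℤ) (c : List ℕ) (t : PT) : Option PT :=
  let y := lastD c 0
  let y0 := y / 1442401
  let y1 := y / 1201 % 1201
  let ym := y % 1201
  let dr : ℤ := ((regN w p ym : ℕ) : ℤ) - ((regN w p (mX + 600) : ℕ) : ℤ)
  let e0 : ℤ := 3 * ((y0 : ℤ) - 600) + dr
  let e1 : ℤ := 3 * ((y1 : ℤ) - 600) + dr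
  let em : ℤ := (ym : ℤ) - 600 - (mX : ℤ)
  let u9 := e0 * e0 + e0 * e1 + e1 * e1 + 6 * em * em
  bif ((u9 ≤ lo : Bool) || (hi < u9 : Bool)) then none else
  let u9n := u9.toNat
  let An : ℕ := AE * c.length
  let u2 := u9n * u9n
  let u4 := u2 * u2
  let cR := (An + u4 - 1) / u4
  let f0 := 2 * e0 + e1
  let f1 := 2 * e1 + e0
  let g := 12 * em
  let C := 3603 * (f0 + f1) + 1201 * g
  walkP w p P9 f0.toNat (-f0).toNat f1.toNat (-f1).toNat g.toNat (-g).toNat C.toNat (-C).toNat An (4 * u4 * u9n) (4 * u9n) cR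
    600 600 (600 + mX) c t

/-- ★ THE SLAB PROGRAM: fold all chords of base residue `mX` into the zero-payload key tree `t0` (`none` = some chord/piece invalid). -/
noncomputable def slabAcc (w : List ℕ) (P9 E mX : ℕ) (lo hi : ℤ) (t0 : PT) (cs : List (List ℕ)) : Option (List (ℕ × ℕ × ℕ)) :=
  let AE := 2 ^ E * 45927
  (cs.foldl (fun acc c => match acc with | none => none | some t => addChord w w.length P9 AE mX lo hi c t) (some t0)).map PT.toList

/-- strictly increasing last codes (⇒ the chords' far sites `Y` are pairwise distinct) — completeness input R4 (b). -/
def lastCodesStrict : List (List ℕ) → Bool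
  | c :: d :: rest => Nat.blt (lastD c 0) (lastD d 0) && lastCodesStrict (d :: rest)
  | _ => true


/-! ## §2 payload-tree lemmas -/

section Tree

variable {q r s : ℕ}

/-- unfolding `bump` at a leaf. [folklore] -/
theorem bump_nil : PT.nil.bump q r s = none := rfl

/-- unfolding `bump` at a node. [folklore] -/
theorem bump_node (l : PT) (k a b : ℕ) (rt : PT) : (PT.node l k a b rt).bump q r s =
    (bif Nat.blt q k then (match l.bump q r s with | none => none | some l' => some (PT.node l' k a b rt))
      else bif Nat.blt k q then (match rt.bump q r s with | none => none | some r' => some (PT.node l k a b r'))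
      else some (PT.node l k (Nat.add a r) (Nat.add b s) rt)) := rfl

/-- unfolding `toList` at a leaf. [folklore] -/
theorem toList_nil : PT.nil.toList = [] := rfl

/-- unfolding `toList` at a node. [folklore] -/
theorem toList_node (l : PT) (k a b : ℕ) (rt : PT) : (PT.node l k a b rt).toList = l.toList ++ (k, a, b) :: rt.toList := rfl

/-- ★ `bump q r s` succeeds only by modifying ONE listed entry whose key is `q`, adding `(r, s)` to its payload; everything else is
unchanged (no search-tree invariant needed). [folklore] -/
theorem toList_bump : ∀ {t t' : PT}, t.bump q r s = some t' →
    ∃ l₁ l₂ : List (ℕ × ℕ × ℕ), ∃ a b : ℕ, t.toList = l₁ ++ (q, a, b) :: l₂ ∧ t'.toList = l₁ ++ (q, a + r, b + s) :: l₂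
  | .nil, t', h => by rw [bump_nil] at h; exact absurd h (by simp)
  | .node l k a b rt, t', h => by
    rw [bump_node] at h
    cases hq : Nat.blt q k
    · rw [hq] at h
      simp only [cond_false] at h
      cases hk : Nat.blt k q
      · rw [hk] at h
        simp only [cond_false, Option.some.injEq] at h
        have hqk : q = k := by
          have h1 : ¬ q < k := fun hlt => by
            have h' : Nat.blt q k = true := by simp only [Nat.blt_eq]; exact hlt
            rw [hq] at h'; exact Bool.false_ne_true h'
          have h2 : ¬ k < q := fun hlt => by
            have h' : Nat.blt k q = true := by simp only [Nat.blt_eq]; exact hlt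
            rw [hk] at h'; exact Bool.false_ne_true h'
          omega
        subst hqk
        refine ⟨l.toList, rt.toList, a, b, toList_node _ _ _ _ _, ?_⟩
        rw [← h, toList_node]; rfl
      · rw [hk] at h
        simp only [cond_true] at h
        cases hr : rt.bump q r s with
        | none => rw [hr] at h; exact absurd h (by simp)
        | some r' =>
          rw [hr] at h
          simp only [Option.some.injEq] at h
          obtain ⟨l₁, l₂, a', b', h1, h2⟩ := toList_bump hr
          refine ⟨l.toList ++ (k, a, b) :: l₁, l₂, a', b', ?_, ?_⟩
          · rw [toList_node, h1]; simp
          · rw [← h, toList_node, h2]; simp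
    · rw [hq] at h
      simp only [cond_true] at h
      cases hl : l.bump q r s with
      | none => rw [hl] at h; exact absurd h (by simp)
      | some l' =>
        rw [hl] at h
        simp only [Option.some.injEq] at h
        obtain ⟨l₁, l₂, a', b', h1, h2⟩ := toList_bump hl
        refine ⟨l₁, l₂ ++ (k, a, b) :: rt.toList, a', b', ?_, ?_⟩
        · rw [toList_node, h1]; simp
        · rw [← h, toList_node, h2]; simp

/-- key-wise R sum of a table list: `Σ_{(k, x, y) ∈ L, k = q} x`. -/
def tabR (L : List (ℕ × ℕ × ℕ)) (q : ℕ) : ℕ := (L.map fun e => if e.1 = q then e.2.1 else 0).sum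
/-- key-wise N sum of a table list: `Σ_{(k, x, y) ∈ L, k = q} y`. -/
def tabN (L : List (ℕ × ℕ × ℕ)) (q : ℕ) : ℕ := (L.map fun e => if e.1 = q then e.2.2 else 0).sum

/-- `tabR` is additive over concatenation. [folklore] -/
theorem tabR_append (L M : List (ℕ × ℕ × ℕ)) (q : ℕ) : tabR (L ++ M) q = tabR L q + tabR M q := by
  simp [tabR, List.map_append, List.sum_append]
/-- `tabN` is additive over concatenation. [folklore] -/
theorem tabN_append (L M : List (ℕ × ℕ × ℕ)) (q : ℕ) : tabN (L ++ M) q = tabN L q + tabN M q := by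
  simp [tabN, List.map_append, List.sum_append]
/-- `tabR` of a cons. [folklore] -/
theorem tabR_cons (e : ℕ × ℕ × ℕ) (L : List (ℕ × ℕ × ℕ)) (q : ℕ) : tabR (e :: L) q = (if e.1 = q then e.2.1 else 0) + tabR L q := by
  simp [tabR]
/-- `tabN` of a cons. [folklore] -/
theorem tabN_cons (e : ℕ × ℕ × ℕ) (L : List (ℕ × ℕ × ℕ)) (q : ℕ) : tabN (e :: L) q = (if e.1 = q then e.2.2 else 0) + tabN L q := by
  simp [tabN]

/-- ★ a successful `bump q r s` adds exactly `r` to the key-wise R sum at `q` and nothing elsewhere. [folklore] -/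
theorem tabR_bump {t t' : PT} (h : t.bump q r s = some t') (q' : ℕ) :
    tabR t'.toList q' = tabR t.toList q' + if q = q' then r else 0 := by
  obtain ⟨l₁, l₂, a, b, h1, h2⟩ := toList_bump h
  rw [h1, h2, tabR_append, tabR_append, tabR_cons, tabR_cons]
  by_cases hq : q = q'
  · simp only [hq, if_true]; ring
  · simp only [hq, if_false]; ring
/-- ★ the same for the N sum. [folklore] -/
theorem tabN_bump {t t' : PT} (h : t.bump q r s = some t') (q' : ℕ) :
    tabN t'.toList q' = tabN t.toList q' + if q = q' then s else 0 := by
  obtain ⟨l₁, l₂, a, b, h1, h2⟩ := toList_bump h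
  rw [h1, h2, tabN_append, tabN_append, tabN_cons, tabN_cons]
  by_cases hq : q = q'
  · simp only [hq, if_true]; ring
  · simp only [hq, if_false]; ring

end Tree

/-! ## §3 the ceiling lemma for the `(a + b − 1) / b` form -/

/-- ★ THE DYADIC CEILING LEMMA: `a / (2^E · b) ≤ ⌈a/b⌉ / 2^E` with `⌈a/b⌉ := (a + b − 1)/b` (ℕ division) — each dyadic coefficient of the
kernel dominates its real (`ℕ` forms of `a/b ≤ ⌈a/b⌉` exist in unrelated Literature files — Ford's program, the Turán box certificates — and
are not imported into this kernel; the three-line argument is inlined). [folklore] -/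
theorem div_pow_le_ceilDivNat (a E : ℕ) {b : ℕ} (hb : 0 < b) :
    (a : ℝ) / (2 ^ E * b) ≤ (((a + b - 1) / b : ℕ) : ℝ) / 2 ^ E := by
  have hmul : a ≤ (a + b - 1) / b * b := by
    have h := Nat.lt_div_mul_add (a := a + b - 1) hb
    omega
  rw [div_le_div_iff₀ (by positivity) (by positivity)]
  calc (a : ℝ) * 2 ^ E ≤ (((a + b - 1) / b * b : ℕ) : ℝ) * 2 ^ E := by exact_mod_cast Nat.mul_le_mul_right _ hmul
    _ = (((a + b - 1) / b : ℕ) : ℝ) * (2 ^ E * b) := by push_cast; ring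

/-! ## §4 the hex-metric Cauchy–Schwarz inequality -/

/-- ★ `d18² ≤ 4·n9·n9'`: with `n9(v) = v₀² + v₀v₁ + v₁² + 6v₂²` (nine times the squared length in refined index coordinates) and
`d18(e, v) = 2e₀v₀ + 2e₁v₁ + e₀v₁ + e₁v₀ + 12e₂v₂` (eighteen times the inner product), Cauchy–Schwarz reads `d18² ≤ 4·n9(e)·n9(v)`;
proof = the Lagrange identity `4·n9·n9' − d18² = 3(e₀v₁ − e₁v₀)² + 6((2e₀+e₁)v₂ − (2v₀+v₁)e₂)² + 18(e₁v₂ − e₂v₁)²`. [folklore] -/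
theorem d18_sq_le_four_n9_n9 (e0 e1 em v0 v1 vm : ℤ) :
    (2 * e0 * v0 + 2 * e1 * v1 + e0 * v1 + e1 * v0 + 12 * em * vm) ^ 2 ≤
      4 * (e0 * e0 + e0 * e1 + e1 * e1 + 6 * em * em) * (v0 * v0 + v0 * v1 + v1 * v1 + 6 * vm * vm) := by
  nlinarith [sq_nonneg (e0 * v1 - e1 * v0), sq_nonneg ((2 * e0 + e1) * vm - (2 * v0 + v1) * em), sq_nonneg (e1 * vm - em * v1)]

/-- `n9` is nonnegative (`v₀² + v₀v₁ + v₁² ≥ 0`). [folklore] -/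
theorem n9_form_nonneg (v0 v1 vm : ℤ) : 0 ≤ v0 * v0 + v0 * v1 + v1 * v1 + 6 * vm * vm := by
  nlinarith [sq_nonneg (2 * v0 + v1), sq_nonneg v1, sq_nonneg vm]

/-! ## §5 offset identities of the hot loop -/

/-- the offset refined coordinate is exact: for shifted coordinates `a, b < 1201` and letters `ra, rb ≤ 2`,
`(3·(b + 1201 − a) + rb − ra : ℕ) = 3(b − a) + (rb − ra) + 3603` in `ℤ`. [folklore] -/
theorem offset_coord (a b ra rb : ℕ) (ha : a < 1201) (hra : ra ≤ 2) :
    ((3 * (b + 1201 - a) + rb - ra : ℕ) : ℤ) = 3 * ((b : ℤ) - a) + ((rb : ℤ) - ra) + 3603 := by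
  have h1 : a ≤ b + 1201 := by omega
  have h2 : ra ≤ 3 * (b + 1201 - a) + rb := by omega
  push_cast [Nat.cast_sub h1, Nat.cast_sub h2]
  ring

/-- the offset layer difference is exact: `(b + 1201 − a : ℕ) = (b − a) + 1201` in `ℤ` for `a < 1201`. [folklore] -/
theorem offset_layer (a b : ℕ) (ha : a < 1201) : ((b + 1201 - a : ℕ) : ℤ) = ((b : ℤ) - a) + 1201 := by
  have h1 : a ≤ b + 1201 := by omega
  push_cast [Nat.cast_sub h1]
  ring

/-- ★ the ℕ expression of the hot loop IS `n9` of the signed refined vector: with `x = v + (3603, 3603, 1201)`,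
`x₀² + x₀x₁ + x₁² + 3·3603² + 6x₂² + 6·1201² − (3·3603·(x₀ + x₁) + 12·1201·x₂) = v₀² + v₀v₁ + v₁² + 6v₂²` (the subtraction is exact
because the right side is ≥ 0). [folklore] -/
theorem offset_n9 (x0 x1 xm : ℕ) (v0 v1 vm : ℤ) (h0 : (x0 : ℤ) = v0 + 3603) (h1 : (x1 : ℤ) = v1 + 3603)
    (hm : (xm : ℤ) = vm + 1201) :
    ((x0 * x0 + x0 * x1 + x1 * x1 + 38944827 + 6 * (xm * xm) + 8654406 - (10809 * (x0 + x1) + 14412 * xm) : ℕ) : ℤ) =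
      v0 * v0 + v0 * v1 + v1 * v1 + 6 * vm * vm := by
  have hnn := n9_form_nonneg v0 v1 vm
  have hle : 10809 * (x0 + x1) + 14412 * xm ≤ x0 * x0 + x0 * x1 + x1 * x1 + 38944827 + 6 * (xm * xm) + 8654406 := by
    have : (10809 * (x0 + x1) + 14412 * xm : ℤ) ≤ x0 * x0 + x0 * x1 + x1 * x1 + 38944827 + 6 * (xm * xm) + 8654406 := by
      rw [h0, h1, hm]; nlinarith [hnn]
    exact_mod_cast this
  push_cast [Nat.cast_sub hle]
  rw [h0, h1, hm]; ring

/-- ★ the sign-split absolute value: `(P − Q) + (Q − P) = |P − Q|` (ℕ truncated subtractions; one of them is `0`). [folklore] -/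
theorem offset_absdiff (P Q : ℕ) : (((P - Q) + (Q - P) : ℕ) : ℤ) = |(P : ℤ) - Q| := by
  rcases le_total P Q with h | h
  · rw [Nat.sub_eq_zero_of_le h, zero_add, abs_of_nonpos (by omega), Nat.cast_sub h]; ring
  · rw [Nat.sub_eq_zero_of_le h, add_zero, abs_of_nonneg (by omega), Nat.cast_sub h]

/-- the sign split of an integer: `z = z.toNat − (−z).toNat`. [folklore] -/
theorem toNat_sub_toNat_neg (z : ℤ) : ((z.toNat : ℕ) : ℤ) - (((-z).toNat : ℕ) : ℤ) = z := by
  rcases le_total 0 z with h | h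
  · rw [Int.toNat_of_nonneg h, Int.toNat_eq_zero.mpr (by omega)]; simp
  · rw [Int.toNat_eq_zero.mpr h, Int.toNat_of_nonneg (by omega)]; simp

/-- ★ the sign-split evaluation of the chord form: with `f = fp − fn` termwise and `C = Cp − Cn`,
`P − Q = f₀x₀ + f₁x₁ + g·x₂ − C` where `P = fp₀x₀ + fp₁x₁ + gp·x₂ + Cn`, `Q = fn₀x₀ + fn₁x₁ + gn·x₂ + Cp`. [folklore] -/
theorem offset_form (f0 f1 g C : ℤ) (x0 x1 xm : ℕ) :
    ((f0.toNat * x0 + f1.toNat * x1 + g.toNat * xm + (-C).toNat : ℕ) : ℤ) -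
        ((((-f0).toNat * x0 + (-f1).toNat * x1 + (-g).toNat * xm + C.toNat : ℕ) : ℤ)) =
      f0 * x0 + f1 * x1 + g * xm - C := by
  have e0 := toNat_sub_toNat_neg f0
  have e1 := toNat_sub_toNat_neg f1
  have eg := toNat_sub_toNat_neg g
  have eC := toNat_sub_toNat_neg C
  push_cast
  linear_combination (x0 : ℤ) * e0 + (x1 : ℤ) * e1 + (xm : ℤ) * eg - eC

/-- ★ the chord form at the offset point equals `d18(e, v)`: `f₀(v₀+3603) + f₁(v₁+3603) + g(v₂+1201) − (3603(f₀+f₁) + 1201g)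
= f₀v₀ + f₁v₁ + g·v₂`, and with `f₀ = 2e₀+e₁`, `f₁ = 2e₁+e₀`, `g = 12e₂` this is `d18`. [folklore] -/
theorem offset_d18 (e0 e1 em v0 v1 vm : ℤ) :
    (2 * e0 + e1) * (v0 + 3603) + (2 * e1 + e0) * (v1 + 3603) + 12 * em * (vm + 1201) -
        (3603 * ((2 * e0 + e1) + (2 * e1 + e0)) + 1201 * (12 * em)) =
      2 * e0 * v0 + 2 * e1 * v1 + e0 * v1 + e1 * v0 + 12 * em * vm := by
  ring

/-! ## §6 the COUNT program (completeness R4 (a), critic r1848 (B): one «…Theta<Word><Res>Count» file per (word, residue))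

The far sites `Y = (γ₀, γ₁, mX + Δm)` of the box `|γ₀|, |γ₁| ≤ GB`, `|Δm| ≤ MB` are scanned ONCE; each site's ideal `n9` from the base
`X = (0, 0, mX)` is located among the slab cut points `cuts = [κ₀, κ₁, …, κ_S]` (window `s` = `κ_s < n9 ≤ κ_{s+1}`) and the count of
window `s` is incremented.  The count file states `countWins w mX GB MB cuts = claimed` by `decide +kernel`; with the box side
conditions (`4·κ_S < 3(3GB+1)²`, `κ_S < 6(MB+1)²`) every site of the window lies in the box (lemma file), so #chords of slab `s` =
count `s` ∧ distinct far sites ∧ all in window ⇒ the slab's chord data cover the window (pigeonhole). -/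

/-- signed `n9` of the far site `(γ₀, γ₁, mX + Δm)` from the base `(0, 0, mX)` (letters by `regN` on shifted layers). -/
def n9Y (w : List ℕ) (p mX : ℕ) (g0 g1 dm : ℤ) : ℤ :=
  let dr : ℤ := ((regN w p (Int.toNat (dm + 600 + mX)) : ℕ) : ℤ) - ((regN w p (600 + mX) : ℕ) : ℤ)
  let v0 := 3 * g0 + dr
  let v1 := 3 * g1 + dr
  v0 * v0 + v0 * v1 + v1 * v1 + 6 * dm * dm

/-- the window index of `u9` among the (natural) cut points: `some s` iff `cuts[s] < u9 ≤ cuts[s+1]`. -/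
def slabIdx : List ℕ → ℕ → Option ℕ
  | κ :: κ' :: rest, u9 =>
    bif Nat.ble u9 κ then none else bif Nat.ble u9 κ' then some 0 else (slabIdx (κ' :: rest) u9).map (· + 1)
  | _, _ => none

/-- increment the `s`-th entry of a list of counts. -/
def incrAt : List ℕ → ℕ → List ℕ
  | [], _ => []
  | n :: rest, 0 => (n + 1) :: rest
  | n :: rest, s + 1 => n :: incrAt rest s

/-- ★ THE COUNT PROGRAM (ℕ only): scan the box offsets `(a, b, c) = (γ₀ + GB, γ₁ + GB, Δm + MB)`, compute the site's `n9` by the offset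
identity `x = 3γ + Δreg + K`, `K = 3GB + 3` (`qhex(v) + 6Δm² = [x₀² + x₀x₁ + x₁² + 3K² + 6c² + 6MB²] − [3K(x₀ + x₁) + 12·MB·c]`, exact in ℕ),
locate its window among `cuts`, increment that count.  Output: one count per window `s < cuts.length − 1`. -/
def countWins (w : List ℕ) (mX GB MB : ℕ) (cuts : List ℕ) : List ℕ :=
  let p := w.length
  let ra := regN w p (600 + mX)
  let K := 3 * GB + 3
  (List.range (2 * GB + 1)).foldl (fun counts a =>
    (List.range (2 * GB + 1)).foldl (fun counts b =>
      (List.range (2 * MB + 1)).foldl (fun counts c =>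
        let rb := regN w p (600 + mX + c - MB)
        let x0 := 3 * a + 3 + rb - ra
        let x1 := 3 * b + 3 + rb - ra
        let u9 := x0 * x0 + x0 * x1 + x1 * x1 + 3 * K * K + 6 * (c * c) + 6 * (MB * MB) - (3 * K * (x0 + x1) + 12 * MB * c)
        match slabIdx cuts u9 with
        | none => counts
        | some s => incrAt counts s) counts) counts) (List.replicate (cuts.length - 1) 0)

end Summit.AtomisticToContinuum.Crystallization.Theorems.ChartedZeroExcessLayeredLatticeLiouville.ThetaKernel
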